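import Summits.Ventures.WeilGRH.TwistedGramCellSignsOddArctan
import Summits.Ventures.WeilGRH.TwistedComplexDataRungJ
import HarnessLib

/-!
# GRH arm (rh-explicit, venture WeilGRH): twisted format C for COMPLEX characters — far-diagonal SIGN facts of the door `_dataJ`
  (first entry brick of the complex χ-cell lane: `h0`, `hd0`, `hw` of `weilPositivityOnChar_of_twistedC_formatC_dataJ` from interval boxes)

Cell `rh-explicit`, WEIL TRACK — GRH ARM (engine seat weil-grh-2 gen10).  The complex data door
`weilPositivityOnChar_of_twistedC_formatC_dataJ` (weil-grh-5, `TwistedComplexDataRungJ.lean`) works on the enumeration `κ` of all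
modes `|p| < B` and asks for the sign facts of the far diagonal in the form
`W(n) = 2·[(Re ψ(¼+iω_n/2) − log π)/2 − 1/(8n) − C/(π²n²) − pen(n) − (C/π²)√(8/(B−1))] − A_op⁺ + log q`
with `pen = π/4` for `h0` (at `n = B`) and `hd0` (at `n = B₃`), and `pen(n) = (π/2 − arctan(√(B−1)/√n))/2` for the column weights
`hw` (`j ∈ [2B−1, 2B₃−1)`, mode `n = (j+1)/2`).  This file is the χ-INDEPENDENT kernel side of those three hypotheses, exactly as
`TwistedGramCellSigns.lean` / `…SignsOddArctan.lean` are for the real doors: the boxes `dhatCBox` (crude `π/4`) and `dhatCBoxA`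
(arctan penalty via `penBox`), the integer comparisons `checkSignsC`, and ★ `signsC_of_checkSignsC` delivering `h0`, `hd0`, `hw`
LITERALLY in the door's shape with `d₀ = d0N·2^{−wbits}`, `w j = wN_{(j+1)/2 − B}·2^{−wbits}`.  Everything is PROVED; computable
`def`s; RH/GRH-free.  References: H. Yoshida (1992) §7 [Yoshida1992HermitianForms]; R. E. Moore (1966) Ch. 3 [Moore1966].
-/

set_option autoImplicit false
set_option linter.style.longLine false

open Real Complex Finset
open scoped BigOperators ArithmeticFunction.vonMangoldt

namespace Summit.Ventures.WeilGRH

open Literature.NumberTheory.LFunctions Literature.NumberTheory.LFunctions.Yoshida1992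
open Literature.NumberTheory.LFunctions.Yoshida1992.Encl
open Literature.Analysis.SpecialFunctions Literature.Analysis.ValidatedNumerics.NumericsMP

namespace TwistedEncl

variable {S : ℕ} {a : ℝ} {q : ℕ}

/-- Complex-door cell data (χ-independent part of the sign facts): block `B` (modes `|p| < B`), column cut `B₃`, the binary unit
of `d₀` and of the weights, `d₀·2^{wbits}`, the per-MODE weights `wN[n − B]` (`B ≤ n < B₃`; the door's `w j` is `wN[(j+1)/2 − B]`),
the boxes `CC ∋ a(1+E(2a))`, `AOP ∋ A_op⁺(a)`, and a rational `r8N/r8D ≥ √(8/(B−1))`. -/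
structure CCellData where
  /-- block size (modes `|p| < B`, matrix size `2B − 1`) -/
  B : ℕ
  /-- column cut -/
  B3 : ℕ
  /-- binary unit of `d₀` and the weights -/
  wbits : ℕ
  /-- `d₀ · 2^{wbits}` -/
  d0N : ℕ
  /-- weights per mode: `w_n · 2^{wbits}`, `n = B … B₃ − 1` -/
  wN : List ℕ
  /-- box of `a(1 + E(2a))` -/
  CC : MI
  /-- box of `A_op⁺(a)` -/
  AOP : MI
  /-- numerator of `r₈ ≥ √(8/(B−1))` -/
  r8N : ℕ
  /-- denominator of `r₈` -/
  r8D : ℕ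

/-- Box of the LOWER crude far weight `2·[(Re ψ − log π)/2 − 1/(8n) − C/(π²n²) − π/4 − (C/π²)r₈] − A_op⁺ + log q`.
[cite: Yoshida1992HermitianForms, §7 pp. 305–312] -/
def dhatCBox (S : ℕ) (C : Consts) (LQ : MI) (tab : List IdxRec) (d : CCellData) (n : ℕ) : MI :=
  let cpi := (d.CC.mul S C.invPi).mul S C.invPi
  (((((((((tget tab n).reP.sub C.logPi).divNat 2).sub (MI.ofFrac S 1 (8 * n))).sub (cpi.divNat (n * n))).sub (C.P.divNat 4)).sub
    ((cpi.mulInt d.r8N).divNat d.r8D)).mulInt 2).sub d.AOP).add LQ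

/-- Box of the LOWER sharp far weight (arctan penalty `(π/2 − arctan(√(B−1)/√n))/2` instead of `π/4`).
[cite: Yoshida1992HermitianForms, §7 pp. 305–312] -/
def dhatCBoxA (S Karc : ℕ) (C : Consts) (LQ : MI) (tab : List IdxRec) (d : CCellData) (n : ℕ) : Option MI :=
  let cpi := (d.CC.mul S C.invPi).mul S C.invPi
  (penBox S Karc C.P (d.B - 1) (n - 1)).map fun Y ↦
    (((((((((tget tab n).reP.sub C.logPi).divNat 2).sub (MI.ofFrac S 1 (8 * n))).sub (cpi.divNat (n * n))).sub Y).sub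
      ((cpi.mulInt d.r8N).divNat d.r8D)).mulInt 2).sub d.AOP).add LQ

/-- The real lower far weight with a general penalty. [cite: Yoshida1992HermitianForms, §7 pp. 305–312] -/
noncomputable def dhatCLow (a Lq Cc Aop r8 pen : ℝ) (n : ℕ) : ℝ :=
  2 * ((reDigammaQuarter (freq a n) - Real.log π) / 2 - 1 / (8 * (n : ℝ)) - Cc / π ^ 2 / ((n : ℝ) * n) - pen - Cc / π ^ 2 * r8) -
    Aop + Lq

/-- Soundness of `dhatCBox` (`1 ≤ n < N`). [cite: Moore1966, Ch. 3 (interval arithmetic: inclusion property)] -/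
theorem mem_dhatCBox (hS : 0 < S) {ks : List PrimeLen} {C : Consts} (hC : ConstsValid S a ks C) {LQ : MI} {Lq : ℝ}
    (hLQ : MI.mem S Lq LQ) {N : ℕ} {tab : List IdxRec} (hT : TabValid S a ks N tab) {d : CCellData} {Cc Aop : ℝ}
    (hCC : MI.mem S Cc d.CC) (hAOP : MI.mem S Aop d.AOP) (hr8D : 0 < d.r8D) {n : ℕ} (hn1 : 1 ≤ n) (hn : n < N) :
    MI.mem S (dhatCLow a Lq Cc Aop ((d.r8N : ℝ) / d.r8D) (π / 4) n) (dhatCBox S C LQ tab d n) := by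
  unfold dhatCBox dhatCLow
  have hcpi : MI.mem S (Cc / π ^ 2) ((d.CC.mul S C.invPi).mul S C.invPi) := by
    refine mem_of_eq (MI.mem_mul hS (MI.mem_mul hS hCC hC.invPi) hC.invPi) ?_
    field_simp
  have hreP := (hT n hn).2.reP
  have h := MI.mem_add (MI.mem_sub (MI.mem_mulInt (MI.mem_sub (MI.mem_sub (MI.mem_sub (MI.mem_sub (MI.mem_divNat
    (MI.mem_sub hreP hC.logPi) (n := 2) (by norm_num)) (MI.mem_ofFrac S 1 (q := 8 * n) (by omega)))
    (MI.mem_divNat hcpi (n := n * n) (Nat.mul_pos hn1 hn1))) (MI.mem_divNat hC.pi (n := 4) (by norm_num)))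
    (MI.mem_divNat (MI.mem_mulInt hcpi d.r8N) hr8D)) 2) hAOP) hLQ
  refine mem_of_eq h ?_
  push_cast
  ring

/-- Soundness of `dhatCBoxA` (`B ≤ n < N`, `1 ≤ n`). [cite: Moore1966, Ch. 3 (interval arithmetic: inclusion property)] -/
theorem mem_dhatCBoxA (hS : 0 < S) {Karc : ℕ} {ks : List PrimeLen} {C : Consts} (hC : ConstsValid S a ks C) {LQ : MI} {Lq : ℝ}
    (hLQ : MI.mem S Lq LQ) {N : ℕ} {tab : List IdxRec} (hT : TabValid S a ks N tab) {d : CCellData} {Cc Aop : ℝ}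
    (hCC : MI.mem S Cc d.CC) (hAOP : MI.mem S Aop d.AOP) (hr8D : 0 < d.r8D) {n : ℕ} (hn1 : 1 ≤ n) (hn : n < N) {Z : MI}
    (hZ : dhatCBoxA S Karc C LQ tab d n = some Z) :
    MI.mem S (dhatCLow a Lq Cc Aop ((d.r8N : ℝ) / d.r8D)
      ((π / 2 - Real.arctan (Real.sqrt ((d.B - 1 : ℕ) : ℝ) / Real.sqrt (n : ℝ))) / 2) n) Z := by
  unfold dhatCBoxA at hZ
  cases hY : penBox S Karc C.P (d.B - 1) (n - 1) with
  | none => simp [hY] at hZ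
  | some Y =>
    simp only [hY, Option.map_some, Option.some.injEq] at hZ
    subst hZ
    unfold dhatCLow
    have hcpi : MI.mem S (Cc / π ^ 2) ((d.CC.mul S C.invPi).mul S C.invPi) := by
      refine mem_of_eq (MI.mem_mul hS (MI.mem_mul hS hCC hC.invPi) hC.invPi) ?_
      field_simp
    have hreP := (hT n hn).2.reP
    have hpen := mem_penBox hS (Karc := Karc) hC.pi hY
    have e : ((n - 1 : ℕ) : ℝ) + 1 = (n : ℝ) := by
      rw [Nat.cast_sub hn1]; push_cast; ring
    rw [e] at hpen
    have h := MI.mem_add (MI.mem_sub (MI.mem_mulInt (MI.mem_sub (MI.mem_sub (MI.mem_sub (MI.mem_sub (MI.mem_divNat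
      (MI.mem_sub hreP hC.logPi) (n := 2) (by norm_num)) (MI.mem_ofFrac S 1 (q := 8 * n) (by omega)))
      (MI.mem_divNat hcpi (n := n * n) (Nat.mul_pos hn1 hn1))) hpen)
      (MI.mem_divNat (MI.mem_mulInt hcpi d.r8N) hr8D)) 2) hAOP) hLQ
    refine mem_of_eq h ?_
    push_cast
    ring

/-- `d̂′ ≤ d̂`: replacing `√(8/(B−1))` by a rational `r₈ ≥` it only lowers the weight (`C ≥ 0`).
[cite: Yoshida1992HermitianForms, §7 pp. 305–312] -/
theorem dhatCLow_le {Lq Cc Aop r8 pen : ℝ} (hCc : 0 ≤ Cc) {B : ℕ} (hr8 : Real.sqrt (8 / ((B - 1 : ℕ) : ℝ)) ≤ r8) (n : ℕ) :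
    dhatCLow a Lq Cc Aop r8 pen n ≤
      2 * ((reDigammaQuarter (freq a n) - Real.log π) / 2 - 1 / (8 * (n : ℝ)) - Cc / (π ^ 2 * (n : ℝ) ^ 2) - pen -
        Cc / π ^ 2 * Real.sqrt (8 / ((B - 1 : ℕ) : ℝ))) - Aop + Lq := by
  unfold dhatCLow
  have hπ : 0 < π ^ 2 := by positivity
  have h1 : Cc / π ^ 2 * Real.sqrt (8 / ((B - 1 : ℕ) : ℝ)) ≤ Cc / π ^ 2 * r8 :=
    mul_le_mul_of_nonneg_left hr8 (div_nonneg hCc hπ.le)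
  have h2 : Cc / π ^ 2 / ((n : ℝ) * n) = Cc / (π ^ 2 * (n : ℝ) ^ 2) := by rw [div_div]; ring
  rw [h2]
  linarith

/-- The sign checks for the complex door: `r₈² ≥ 8/(B−1)`, `W′_{π/4}(B) > 0`, `d₀ ≤ W′_{π/4}(B₃)`, and per mode
`n = B + c < B₃`: `0 < wN[c]`, `wN[c]·2^{−wbits} ≤ W′_arctan(n)`. [cite: Moore1966, Ch. 3 (interval arithmetic: inclusion property)] -/
def checkSignsC (S Karc : ℕ) (C : Consts) (LQ : MI) (tab : List IdxRec) (d : CCellData) : Bool :=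
  decide (2 ≤ d.B) && decide (2 * d.B ≤ d.B3) && decide (0 < d.r8D) && decide (0 < d.d0N) &&
    decide (8 * d.r8D ^ 2 ≤ (d.B - 1) * d.r8N ^ 2) &&
    decide (0 < (dhatCBox S C LQ tab d d.B).lo) &&
    decide ((d.d0N : ℤ) * S ≤ (dhatCBox S C LQ tab d d.B3).lo * 2 ^ d.wbits) &&
    (List.range (d.B3 - d.B)).all fun c ↦ decide (0 < d.wN.getD c 0) &&
      match dhatCBoxA S Karc C LQ tab d (d.B + c) with
      | some Z => decide ((d.wN.getD c 0 : ℤ) * S ≤ Z.lo * 2 ^ d.wbits)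
      | none => false

/-- ★ **The complex door's sign facts from checked boxes**: `checkSignsC = true`, valid constants / table below `N > B₃` /
boxes `LQ ∋ log q`, `CC ∋ a(1 + weilArchDensity(2a))`, `AOP ∋ A_op⁺(a)` ⇒ `h0`, `hd0`, `hw` of
`weilPositivityOnChar_of_twistedC_formatC_dataJ` (B := d.B, B₃ := d.B3) with `d₀ = d0N·2^{−wbits}` and
`w j = wN_{(j+1)/2 − B}·2^{−wbits}`. [cite: Yoshida1992HermitianForms, §7 pp. 305–312] -/
theorem signsC_of_checkSignsC (hS : 0 < S) (ha0 : 0 < a) {Karc : ℕ} {ks : List PrimeLen} {C : Consts}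
    (hC : ConstsValid S a ks C) {LQ : MI} (hLQ : MI.mem S (Real.log q) LQ) {N : ℕ} {tab : List IdxRec}
    (hT : TabValid S a ks N tab) {d : CCellData} (hN : d.B3 < N)
    (hCC : MI.mem S (a * (1 + weilArchDensity (2 * a))) d.CC)
    (hAOP : MI.mem S (∑ k ∈ weilPrimeIndex a, (Λ k : ℝ) / Real.sqrt k * (2 * Real.cos (π / (⌊2 * a / Real.log k⌋₊ + 2)))) d.AOP)
    (h : checkSignsC S Karc C LQ tab d = true) :
    (0 < (2 * ((reDigammaQuarter (freq a d.B) - Real.log π) / 2 - 1 / (8 * (d.B : ℝ)) - a * (1 + weilArchDensity (2 * a)) / (π ^ 2 * (d.B : ℝ) ^ 2) - π / 4 - a * (1 + weilArchDensity (2 * a)) / π ^ 2 * Real.sqrt (8 / ((d.B - 1 : ℕ) : ℝ))) - (∑ k ∈ weilPrimeIndex a, (Λ k : ℝ) / Real.sqrt k * (2 * Real.cos (π / (⌊2 * a / Real.log k⌋₊ + 2)))) + Real.log q)) ∧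
    (0 < (d.d0N : ℝ) / 2 ^ d.wbits ∧ (d.d0N : ℝ) / 2 ^ d.wbits ≤ (2 * ((reDigammaQuarter (freq a d.B3) - Real.log π) / 2 - 1 / (8 * (d.B3 : ℝ)) - a * (1 + weilArchDensity (2 * a)) / (π ^ 2 * (d.B3 : ℝ) ^ 2) - π / 4 - a * (1 + weilArchDensity (2 * a)) / π ^ 2 * Real.sqrt (8 / ((d.B - 1 : ℕ) : ℝ))) - (∑ k ∈ weilPrimeIndex a, (Λ k : ℝ) / Real.sqrt k * (2 * Real.cos (π / (⌊2 * a / Real.log k⌋₊ + 2)))) + Real.log q)) ∧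
    (∀ j : ℕ, 2 * d.B - 1 ≤ j → j < 2 * d.B3 - 1 → 0 < (d.wN.getD ((j + 1) / 2 - d.B) 0 : ℝ) / 2 ^ d.wbits ∧ (d.wN.getD ((j + 1) / 2 - d.B) 0 : ℝ) / 2 ^ d.wbits ≤ (2 * ((reDigammaQuarter (freq a ((j + 1) / 2 : ℕ)) - Real.log π) / 2 - 1 / (8 * (((j + 1) / 2 : ℕ) : ℝ)) - a * (1 + weilArchDensity (2 * a)) / (π ^ 2 * (((j + 1) / 2 : ℕ) : ℝ) ^ 2) - (π / 2 - Real.arctan (Real.sqrt ((d.B - 1 : ℕ) : ℝ) / Real.sqrt (((j + 1) / 2 : ℕ) : ℝ))) / 2 - a * (1 + weilArchDensity (2 * a)) / π ^ 2 * Real.sqrt (8 / ((d.B - 1 : ℕ) : ℝ))) - (∑ k ∈ weilPrimeIndex a, (Λ k : ℝ) / Real.sqrt k * (2 * Real.cos (π / (⌊2 * a / Real.log k⌋₊ + 2)))) + Real.log q)) := by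
  unfold checkSignsC at h
  simp only [Bool.and_eq_true, decide_eq_true_eq, List.all_eq_true, List.mem_range] at h
  obtain ⟨⟨⟨⟨⟨⟨⟨hB2, hBB3⟩, hr8D⟩, hd0N⟩, hr8⟩, h0⟩, hd0⟩, hw⟩ := h
  set Cc := a * (1 + weilArchDensity (2 * a)) with hCc
  set Aop := ∑ k ∈ weilPrimeIndex a, (Λ k : ℝ) / Real.sqrt k * (2 * Real.cos (π / (⌊2 * a / Real.log k⌋₊ + 2))) with hAop
  have hCc0 : 0 ≤ Cc := by
    have hE : 0 < weilArchDensity (2 * a) := weilArchDensity_pos (by positivity)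
    positivity
  have hπ2 : 0 < π ^ 2 := by positivity
  have hr8' : Real.sqrt (8 / ((d.B - 1 : ℕ) : ℝ)) ≤ (d.r8N : ℝ) / d.r8D := by
    have hB1 : (0 : ℝ) < ((d.B - 1 : ℕ) : ℝ) := by exact_mod_cast (show 0 < d.B - 1 by omega)
    have hrD : (0 : ℝ) < d.r8D := by exact_mod_cast hr8D
    have hq' : (8 : ℝ) / ((d.B - 1 : ℕ) : ℝ) ≤ ((d.r8N : ℝ) / d.r8D) ^ 2 := by
      have h' : (8 : ℝ) * (d.r8D : ℝ) ^ 2 ≤ ((d.B - 1 : ℕ) : ℝ) * (d.r8N : ℝ) ^ 2 := by exact_mod_cast hr8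
      rw [div_pow, div_le_div_iff₀ hB1 (by positivity)]
      linarith
    calc Real.sqrt (8 / ((d.B - 1 : ℕ) : ℝ)) ≤ Real.sqrt (((d.r8N : ℝ) / d.r8D) ^ 2) := Real.sqrt_le_sqrt hq'
      _ = (d.r8N : ℝ) / d.r8D := Real.sqrt_sq (by positivity)
  have hSr : (0 : ℝ) < S := by exact_mod_cast hS
  -- crude steps (π/4)
  have step : ∀ n, 1 ≤ n → n < N →
      ((dhatCBox S C LQ tab d n).lo : ℝ) ≤ S * (2 * ((reDigammaQuarter (freq a n) - Real.log π) / 2 - 1 / (8 * (n : ℝ)) -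
        Cc / (π ^ 2 * (n : ℝ) ^ 2) - π / 4 - Cc / π ^ 2 * Real.sqrt (8 / ((d.B - 1 : ℕ) : ℝ))) - Aop + Real.log q) := by
    intro n hn1 hnN
    have hmem := (mem_dhatCBox hS hC hLQ hT hCC hAOP hr8D hn1 hnN).1
    have hle := dhatCLow_le (a := a) (Lq := Real.log q) (Aop := Aop) (pen := π / 4) hCc0 hr8' n
    nlinarith
  refine ⟨?_, ⟨by positivity, ?_⟩, fun j hBj hjB3 ↦ ⟨?_, ?_⟩⟩
  · have h1 := step d.B (by omega) (by omega)
    have h0' : (0 : ℝ) < (dhatCBox S C LQ tab d d.B).lo := by exact_mod_cast h0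
    have h3 := lt_of_lt_of_le h0' h1
    rcases pos_and_pos_or_neg_and_neg_of_mul_pos h3 with ⟨_, h⟩ | ⟨h, _⟩
    · exact h
    · exact absurd h (not_lt.2 hSr.le)
  · have h1 := step d.B3 (by omega) hN
    have hd0' : ((d.d0N : ℤ) : ℝ) * S ≤ ((dhatCBox S C LQ tab d d.B3).lo : ℝ) * 2 ^ d.wbits := by exact_mod_cast hd0
    have h2 : (0 : ℝ) < 2 ^ d.wbits := by positivity
    rw [div_le_iff₀ h2]
    push_cast at hd0' h1 ⊢
    nlinarith
  · have hc : (j + 1) / 2 - d.B < d.B3 - d.B := by omega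
    have := (hw ((j + 1) / 2 - d.B) hc).1
    positivity
  · have hc : (j + 1) / 2 - d.B < d.B3 - d.B := by omega
    have hn1 : 1 ≤ (j + 1) / 2 := by omega
    have hnN : (j + 1) / 2 < N := by omega
    have hw' := (hw ((j + 1) / 2 - d.B) hc).2
    rw [show d.B + ((j + 1) / 2 - d.B) = (j + 1) / 2 by omega] at hw'
    split at hw'
    · rename_i Z hZ
      simp only [decide_eq_true_eq] at hw'
      have hmem := (mem_dhatCBoxA hS hC hLQ hT hCC hAOP hr8D hn1 hnN hZ).1
      have hle := dhatCLow_le (a := a) (Lq := Real.log q) (Aop := Aop)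
        (pen := (π / 2 - Real.arctan (Real.sqrt ((d.B - 1 : ℕ) : ℝ) / Real.sqrt (((j + 1) / 2 : ℕ) : ℝ))) / 2) hCc0 hr8' ((j + 1) / 2)
      have h1 : ((Z.lo : ℤ) : ℝ) ≤ S * (2 * ((reDigammaQuarter (freq a ((j + 1) / 2 : ℕ)) - Real.log π) / 2 -
          1 / (8 * (((j + 1) / 2 : ℕ) : ℝ)) - Cc / (π ^ 2 * (((j + 1) / 2 : ℕ) : ℝ) ^ 2) -
          (π / 2 - Real.arctan (Real.sqrt ((d.B - 1 : ℕ) : ℝ) / Real.sqrt (((j + 1) / 2 : ℕ) : ℝ))) / 2 -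
          Cc / π ^ 2 * Real.sqrt (8 / ((d.B - 1 : ℕ) : ℝ))) - Aop + Real.log q) := by
        nlinarith
      have hw'' : ((d.wN.getD ((j + 1) / 2 - d.B) 0 : ℤ) : ℝ) * S ≤ ((Z.lo : ℤ) : ℝ) * 2 ^ d.wbits := by exact_mod_cast hw'
      have h2 : (0 : ℝ) < 2 ^ d.wbits := by positivity
      rw [div_le_iff₀ h2]
      push_cast at hw'' h1 ⊢
      nlinarith
    · simp at hw'

end TwistedEncl

end Summit.Ventures.WeilGRH
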